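import Summits.ResolutionOfSingularities.ResolutionOfSingularities.Theorems.FrobeniusLadderFInjectiveMacaulayficationMonomialCoverRecord
import Mathlib.RingTheory.Polynomial.Eisenstein.Basic
import Mathlib.RingTheory.Polynomial.Content
import Mathlib.RingTheory.Polynomial.UniqueFactorization
import Mathlib.Algebra.Polynomial.Degree.SmallDegree
import Mathlib.Algebra.MvPolynomial.Equiv
import Mathlib.Algebra.MvPolynomial.Division
import Mathlib.Algebra.MvPolynomial.PDeriv
import Mathlib.LinearAlgebra.Matrix.NonsingularInverse
import Mathlib.Algebra.CharP.Lemmas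
import HarnessLib

/-!
# #4β at the WILD PINCH POINT, part 1/2: the fan of `Bl_{(y,t)} 𝔸³` and the polynomial identities of `y² + u²ty + ut²`
# (crux `FInjectiveMacaulayfication` stmt-ResolutionOfSingularities-15315, chain w45a, door v30 = DM ∧ #4β ∧ FC″)

[OURS · L1 W4.5a · res-L1-w45a-lead-1 gen 5] Support file (`--supports stmt-ResolutionOfSingularities-15315 --as helper`); NOT a
statement of any manuscript; AI-written, weaker than expert review.

The specimen. `k` a field of characteristic `2`, `f = y² + u²ty + ut² ∈ k[y,u,t]` (variables `(y,u,t) = (X₀,X₁,X₂)`),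
`X₁ = Spec R̄`, `R̄ = k[X]/(f)` — res-L1-w45a-strat-1's WILD PINCH (`H4LOC-KILL-WILDPINCH.md`, Thm W; plan-1 RULING R13.34): its
origin is a bad point at which the guarded step 5e (`h4Loc`, point-fixability) FAILS, which is why door v30 registers the closed-centre
form #4β (`stub_closedCentreExists`: SOME non-zero ideal sheaf `J` through the bad point all of whose blowings up are FULL over
`supp J`). This pair of files proves #4β's conclusion for this specimen, at every point of `D = V(y,t) = Sing X₁` (in particular at the
origin), with the centre `J = 𝓘_D = (ȳ, t̄)~`:

* §1 `Fan02of3.*` — the two-chart fan of the blowing up of `𝔸³` along the line `y = t = 0` (tables, `decide`), in the binder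
  shapes of (C1) `MonomialChartPresentationKernel.exists_monomialChartPresentation` (the padded monomial centre
  `I_A = (y, t, y², t², yu, tu) = (y, t)`);
* §2 polynomial identities: the strict transforms `g₀ = 1 + u²T + uT²` (chart `y`), `g₁ = S² + u²S + u` (chart `t`), their
  partial derivatives, `f` prime (Eisenstein at `(u) ⊂ k[u,t]` for the monic quadratic `f ∈ k[u,t][y]`) and dividing no variable;
* (part 2) §3 `affineBlowup_full` — EVERY stalk of `Bl_{(ȳ,t̄)} X₁` is a domain satisfying the crux clause: the base is regular off `D`
  (`∂f/∂u = t²`), both charts are regular hypersurfaces (`∂g₁/∂u = 1`; `∂g₀/∂T = u²` with `u` a unit along `g₀ = 0 ∩ V(u) = ∅`),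
  by the Jacobian discharger `ClauseOfPderivNotMem.stub_clauseOfPderivNotMem` and the chart glue
  `BlowupFiModelOfCoverOverClosed.blowupClause_over_closed` (with `𝔟 = 0`);
* (part 2) §4 `closedCentreExists_wildPinch` — the #4β package: `J = (ȳ,t̄)~ ≠ ⊥`, every point of `D` lies in `supp J`, and EVERY blowing
  up `π : X' → X₁` along `J` is FULL at EVERY point (`IsBlowupStalkTransfer`).

So the wild pinch, which kills the point form 5e, passes the closed-centre form #4β with the reduced singular locus as centre —
the first worked WILD point of the crux chain (strat-1's `WFix` line, dimension 2). [folklore mathematics: blowing up the pinch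
line resolves the surface; the content here is the certificate in the crux's clause language]
-/

-- single-problem summit: the doubled namespace component is forced
set_option linter.dupNamespace false

noncomputable section

namespace Summit.ResolutionOfSingularities.ResolutionOfSingularities.Theorems.FInjectiveMacaulayfication.WildPinchClosedCentre

open MvPolynomial
open Summit.ResolutionOfSingularities.ResolutionOfSingularities.Theorems.FInjectiveMacaulayfication

/-! ## §1 The fan of the blowing up of `𝔸³ = Spec k[y,u,t]` along the line `y = t = 0` (`J = {0,2}`, free index `1`) -/

namespace Fan02of3

/-- The centre's coordinate set. -/
def J : Finset (Fin 3) := {0, 2}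

/-- Chart `c` inverts `X_{jc c}`. -/
def jc : Fin 2 → Fin 3 := ![0, 2]

/-- Records `(a, c, r)` with `a = m c + r` (one per element of `A`). [table] -/
def RL : List ((Fin 3 → ℕ) × Fin 2 × (Fin 3 → ℕ)) :=
  [(![1,0,0], 0, ![0,0,0]), (![0,0,1], 1, ![0,0,0]), (![2,0,0], 0, ![1,0,0]), (![0,0,2], 1, ![0,0,1]),
   (![1,1,0], 0, ![0,1,0]), (![0,1,1], 1, ![0,1,0])]

/-- The exponent set `A` of the (padded) centre `(y, t, y², t², yu, tu) = (y, t)`. [table] -/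
noncomputable def A : Finset (Fin 3 →₀ ℕ) := (RL.map fun ρ => Finsupp.equivFunOnFinite.symm ρ.1).toFinset

/-- Vertices (raw). [table] -/
def mF : Fin 2 → (Fin 3 → ℕ) := ![![1,0,0], ![0,0,1]]

/-- Edges (raw). [table] -/
def aF : Fin 2 → Fin 3 → (Fin 3 → ℕ) :=
  ![![![2,0,0], ![1,1,0], ![0,0,1]],
    ![![1,0,0], ![0,1,1], ![0,0,2]]]

/-- Vertices. -/
noncomputable def m : Fin 2 → (Fin 3 →₀ ℕ) := fun c => Finsupp.equivFunOnFinite.symm (mF c)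

/-- Edges. -/
noncomputable def a : Fin 2 → Fin 3 → (Fin 3 →₀ ℕ) := fun c i => Finsupp.equivFunOnFinite.symm (aF c i)

/-- Chart matrices (`θ_c (X_j) = ∏ i, X_i ^ V c i j`): chart `0` is `t ↦ y t`, chart `1` is `y ↦ t y`. [table] -/
def V : Fin 2 → Matrix (Fin 3) (Fin 3) ℕ :=
  ![!![1,0,1; 0,1,0; 0,0,1],
    !![1,0,0; 0,1,0; 1,0,1]]

/-- Their inverses over `ℤ`. [table] -/
def U : Fin 2 → Matrix (Fin 3) (Fin 3) ℤ :=
  ![!![1,0,-1; 0,1,0; 0,0,1],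
    !![1,0,0; 0,1,0; -1,0,1]]

/-- `V c * U c = 1` over `ℤ`. [table check] -/
theorem V_mul_U : ∀ c : Fin 2, ((V c).map (Nat.cast : ℕ → ℤ)) * U c = 1 := by decide +kernel

/-- The edge relation `V·(a c i) = V·(m c) + e_i`, on tables. [table check] -/
theorem gen_table : ∀ (c : Fin 2) (i j : Fin 3),
    (V c).mulVec (aF c i) j = (V c).mulVec (mF c) j + (if i = j then 1 else 0) := by decide +kernel

/-- The vertex minimises every `V c`-weight over `A`, on tables. [table check] -/
theorem ge_table : ∀ (c : Fin 2), ∀ ρ ∈ RL, ∀ j : Fin 3, (V c).mulVec (mF c) j ≤ (V c).mulVec ρ.1 j := by decide +kernel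

/-- The cover records `a = m c + r`, on tables. [table check] -/
theorem rec_table : ∀ ρ ∈ RL, ∀ j : Fin 3, ρ.1 j = mF ρ.2.1 j + ρ.2.2 j := by decide +kernel

/-- Vertices and edges are elements of `A`, on tables. [table check] -/
theorem mem_table : ∀ c : Fin 2, (∃ ρ ∈ RL, ρ.1 = mF c) ∧ ∀ i : Fin 3, ∃ ρ ∈ RL, ρ.1 = aF c i := by decide +kernel

/-- Every exponent of `A` involves a centre variable, on tables. [table check] -/
theorem pos_table : ∀ ρ ∈ RL, ∃ j ∈ J, 0 < ρ.1 j := by decide +kernel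

/-- The inverted variable's edge is twice the vertex, on tables. [table check] -/
theorem two_table : ∀ (c : Fin 2) (j : Fin 3), aF c (jc c) j = 2 * mF c j := by decide +kernel

/-- Membership in `A` from membership in the record list. [folklore] -/
theorem mem_A_of_mem {x : Fin 3 → ℕ} (h : ∃ ρ ∈ RL, ρ.1 = x) : (Finsupp.equivFunOnFinite.symm x : Fin 3 →₀ ℕ) ∈ A := by
  obtain ⟨ρ, hρ, rfl⟩ := h
  exact List.mem_toFinset.mpr (List.mem_map.mpr ⟨ρ, hρ, rfl⟩)

/-- Elements of `A` come from the record list. [folklore] -/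
theorem exists_of_mem_A {x : Fin 3 →₀ ℕ} (h : x ∈ A) : ∃ ρ ∈ RL, Finsupp.equivFunOnFinite.symm ρ.1 = x := by
  obtain ⟨ρ, hρ, h⟩ := List.mem_map.mp (List.mem_toFinset.mp h)
  exact ⟨ρ, hρ, h⟩

/-- **`hAJ`** (every exponent involves a centre variable). -/
theorem hAJ : ∀ x ∈ A, ∃ j ∈ J, 0 < x j := by
  intro x hx
  obtain ⟨ρ, hρ, rfl⟩ := exists_of_mem_A hx
  obtain ⟨j, hj, h⟩ := pos_table ρ hρ
  exact ⟨j, hj, by simpa using h⟩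

/-- **`hcov`** (`K = 1` records). -/
theorem hcov (k : Type) [Field k] : ∀ x ∈ A, ∃ (c : Fin 2) (K : ℕ), 1 ≤ K ∧
    ∃ y ∈ (Ideal.span ((fun b : Fin 3 →₀ ℕ => (MvPolynomial.monomial b (1 : k) : MvPolynomial (Fin 3) k)) ''
        (A : Set (Fin 3 →₀ ℕ)))) ^ (K - 1),
      (MvPolynomial.monomial x (1 : k) : MvPolynomial (Fin 3) k) ^ K = MvPolynomial.monomial (m c) 1 * y := by
  intro x hx
  obtain ⟨ρ, hρ, rfl⟩ := exists_of_mem_A hx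
  refine MonomialCoverRecord.hcov_of_record_one k A m _ ρ.2.1 (Finsupp.equivFunOnFinite.symm ρ.2.2) ?_
  ext j
  simpa [m] using rec_table ρ hρ j

/-- **`hV`**. -/
theorem hV : ∀ c : Fin 2, IsUnit ((V c).map (Nat.cast : ℕ → ℤ)).det :=
  fun c => Matrix.isUnit_det_of_right_inverse (V_mul_U c)

/-- **`haA`**. -/
theorem haA : ∀ (c : Fin 2) (i : Fin 3), a c i ∈ A := fun c i => mem_A_of_mem ((mem_table c).2 i)

/-- `m c ∈ A`. -/
theorem hmA : ∀ c : Fin 2, m c ∈ A := fun c => mem_A_of_mem (mem_table c).1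

/-- **`hgen`**. -/
theorem hgen : ∀ (c : Fin 2) (i : Fin 3),
    (Finsupp.equivFunOnFinite.symm ((V c).mulVec ⇑(a c i)) : Fin 3 →₀ ℕ) =
      Finsupp.equivFunOnFinite.symm ((V c).mulVec ⇑(m c)) + Finsupp.single i 1 := by
  intro c i
  ext j
  simpa [a, m, Finsupp.single_apply] using gen_table c i j

/-- **`hge`**. -/
theorem hge : ∀ (c : Fin 2), ∀ e ∈ A,
    (Finsupp.equivFunOnFinite.symm ((V c).mulVec ⇑(m c)) : Fin 3 →₀ ℕ) ≤
      Finsupp.equivFunOnFinite.symm ((V c).mulVec ⇑e) := by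
  intro c e he
  obtain ⟨ρ, hρ, rfl⟩ := exists_of_mem_A he
  exact Finsupp.le_def.mpr fun j => by simpa [m] using ge_table c ρ hρ j

/-- **`hunit`** for the exceptional multiplicity `2`: `4 • m c = ∑ j, (2 e_{jc c}) j • a c j + 0`. -/
theorem hunit : ∀ c : Fin 2, ∃ (N : ℕ) (r' : Fin 3 →₀ ℕ),
    N • m c = ∑ j : Fin 3, (Finsupp.single (jc c) 2 : Fin 3 →₀ ℕ) j • a c j + r' := by
  intro c
  refine ⟨2 * 2, 0, ?_⟩
  rw [add_zero]
  rw [Finset.sum_eq_single (jc c) (fun j _ hj => by rw [Finsupp.single_eq_of_ne hj, zero_smul])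
    (fun h => absurd (Finset.mem_univ _) h), Finsupp.single_eq_same]
  ext j
  simp only [m, a, Finsupp.smul_apply, Finsupp.coe_equivFunOnFinite_symm, smul_eq_mul, two_table c j]
  ring

/-- `m c = e_{jc c}`. [table check] -/
theorem m_eq_single : ∀ c : Fin 2, m c = Finsupp.single (jc c) 1 := by
  intro c
  ext j
  fin_cases c <;> fin_cases j <;> simp [m, mF, jc]

end Fan02of3

/-! ## §2 Polynomial identities for the wild pinch `f = y² + u²ty + ut²` (`(y,u,t) = (X₀,X₁,X₂)`) -/

/-- If a polynomial does not vanish at a point where `X_i` does, `X_i` does not divide it. [folklore] -/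
theorem not_X_dvd_of_eval {k : Type} [Field k] {n : ℕ} (P : Fin n → k) (i : Fin n) (hPi : P i = 0)
    (g : MvPolynomial (Fin n) k) (hg : MvPolynomial.eval P g ≠ 0) : ¬ (X i ∣ g) := by
  rintro ⟨q, rfl⟩
  exact hg (by rw [map_mul, eval_X, hPi, zero_mul])

/-- **Chart `y` (inverting `ȳ`, `t ↦ yT`): `θ₀ f = y² · g₀`, `g₀ = 1 + u²T + uT²`.** [folklore] -/
theorem theta_zero {k : Type} [Field k] (f : MvPolynomial (Fin 3) k) (hf : f = X 0 ^ 2 + X 1 ^ 2 * X 2 * X 0 + X 1 * X 2 ^ 2) :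
    aeval (fun j : Fin 3 => ∏ i : Fin 3, (X i : MvPolynomial (Fin 3) k) ^ Fan02of3.V 0 i j) f =
      monomial (Finsupp.single (Fan02of3.jc 0) 2) (1 : k) * (1 + X 1 ^ 2 * X 2 + X 1 * X 2 ^ 2) := by
  rw [hf, show Fan02of3.jc 0 = (0 : Fin 3) from rfl, ← X_pow_eq_monomial]
  simp only [map_add, map_mul, map_pow, aeval_X, Fin.prod_univ_three, Fan02of3.V]
  simp
  ring

/-- **Chart `t` (inverting `t̄`, `y ↦ tS`): `θ₁ f = t² · g₁`, `g₁ = S² + u²S + u`.** [folklore] -/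
theorem theta_one {k : Type} [Field k] (f : MvPolynomial (Fin 3) k) (hf : f = X 0 ^ 2 + X 1 ^ 2 * X 2 * X 0 + X 1 * X 2 ^ 2) :
    aeval (fun j : Fin 3 => ∏ i : Fin 3, (X i : MvPolynomial (Fin 3) k) ^ Fan02of3.V 1 i j) f =
      monomial (Finsupp.single (Fan02of3.jc 1) 2) (1 : k) * (X 0 ^ 2 + X 1 ^ 2 * X 0 + X 1) := by
  rw [hf, show Fan02of3.jc 1 = (2 : Fin 3) from rfl, ← X_pow_eq_monomial]
  simp only [map_add, map_mul, map_pow, aeval_X, Fin.prod_univ_three, Fan02of3.V]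
  simp
  ring

/-- No variable divides `g₀ = 1 + u²T + uT²` (it does not vanish at the origin). [folklore] -/
theorem hcop_zero {k : Type} [Field k] : ∀ i : Fin 3, ¬ (X i ∣ (1 + X 1 ^ 2 * X 2 + X 1 * X 2 ^ 2 : MvPolynomial (Fin 3) k)) :=
  fun i => not_X_dvd_of_eval (fun _ => 0) i rfl _ (by simp)

/-- No variable divides `g₁ = S² + u²S + u` (values `1` at `(0,1,0)` and at `(1,0,0)`). [folklore] -/
theorem hcop_one {k : Type} [Field k] : ∀ i : Fin 3, ¬ (X i ∣ (X 0 ^ 2 + X 1 ^ 2 * X 0 + X 1 : MvPolynomial (Fin 3) k)) := by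
  intro i
  fin_cases i
  · exact not_X_dvd_of_eval ![0, 1, 0] 0 rfl _ (by simp)
  · exact not_X_dvd_of_eval ![1, 0, 0] 1 rfl _ (by simp)
  · exact not_X_dvd_of_eval ![1, 0, 0] 2 rfl _ (by simp)

/-- `(2 : k[X]) = 0` in characteristic `2`. -/
theorem two_eq_zero (k : Type) [Field k] [CharP k 2] {n : ℕ} : (2 : MvPolynomial (Fin n) k) = 0 := by
  have h := CharP.cast_eq_zero (MvPolynomial (Fin n) k) 2
  simpa using h

/-- `∂g₀/∂T = u²` in characteristic `2`. [folklore] -/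
theorem pderiv_two_g0 (k : Type) [Field k] [CharP k 2] :
    pderiv 2 (1 + X 1 ^ 2 * X 2 + X 1 * X 2 ^ 2 : MvPolynomial (Fin 3) k) = X 1 ^ 2 := by
  have h : pderiv 2 (1 + X 1 ^ 2 * X 2 + X 1 * X 2 ^ 2 : MvPolynomial (Fin 3) k) = X 1 ^ 2 + 2 * (X 1 * X 2) := by
    simp only [map_add, pderiv_one, pderiv_mul, pderiv_pow, pderiv_X_self, pderiv_X_of_ne (show (1 : Fin 3) ≠ 2 by decide)]
    push_cast
    ring
  rw [h, two_eq_zero k, zero_mul, add_zero]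

/-- `∂g₁/∂u = 1` in characteristic `2`. [folklore] -/
theorem pderiv_one_g1 (k : Type) [Field k] [CharP k 2] :
    pderiv 1 (X 0 ^ 2 + X 1 ^ 2 * X 0 + X 1 : MvPolynomial (Fin 3) k) = 1 := by
  have h : pderiv 1 (X 0 ^ 2 + X 1 ^ 2 * X 0 + X 1 : MvPolynomial (Fin 3) k) = 2 * (X 1 * X 0) + 1 := by
    simp only [map_add, pderiv_mul, pderiv_pow, pderiv_X_self, pderiv_X_of_ne (show (0 : Fin 3) ≠ 1 by decide)]
    push_cast
    ring
  rw [h, two_eq_zero k, zero_mul, zero_add]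

/-- `∂f/∂u = t²` in characteristic `2`. [folklore] -/
theorem pderiv_one_f (k : Type) [Field k] [CharP k 2] (f : MvPolynomial (Fin 3) k)
    (hf : f = X 0 ^ 2 + X 1 ^ 2 * X 2 * X 0 + X 1 * X 2 ^ 2) : pderiv 1 f = X 2 ^ 2 := by
  have h : pderiv 1 f = 2 * (X 1 * X 2 * X 0) + X 2 ^ 2 := by
    rw [hf]
    simp only [map_add, pderiv_mul, pderiv_pow, pderiv_X_self, pderiv_X_of_ne (show (0 : Fin 3) ≠ 1 by decide),
      pderiv_X_of_ne (show (2 : Fin 3) ≠ 1 by decide)]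
    push_cast
    ring
  rw [h, two_eq_zero k, zero_mul, zero_add]

/-- **`f = y² + u²ty + ut²` is prime and divides no variable** (any field): under `k[X₀,X₁,X₂] ≃ k[Y₀,Y₁][T]` (`X₀ ↦ T`),
`f ↦ T² + Y₀²Y₁·T + Y₀Y₁²`, a monic quadratic which is Eisenstein at the prime `(Y₀)`; a prime of `T`-degree `2` divides neither
`T` nor a constant. [folklore] -/
theorem prime_wildPinch (k : Type) [Field k] (f : MvPolynomial (Fin 3) k)
    (hf : f = X 0 ^ 2 + X 1 ^ 2 * X 2 * X 0 + X 1 * X 2 ^ 2) : Prime f ∧ ∀ j : Fin 3, ¬ (f ∣ X j) := by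
  set e : MvPolynomial (Fin 3) k ≃+* Polynomial (MvPolynomial (Fin 2) k) := (finSuccEquiv k 2).toRingEquiv with he_def
  have he0 : e (X 0) = Polynomial.X := finSuccEquiv_X_zero
  have he1 : e (X 1) = Polynomial.C (X 0) := finSuccEquiv_X_succ (j := 0)
  have he2 : e (X 2) = Polynomial.C (X 1) := finSuccEquiv_X_succ (j := 1)
  set q : Polynomial (MvPolynomial (Fin 2) k) :=
    Polynomial.C (X 0 ^ 2 * X 1) * Polynomial.X + Polynomial.C (X 0 * X 1 ^ 2) with hq
  have hef : e f = Polynomial.X ^ 2 + q := by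
    rw [hf, hq]
    simp only [map_add, map_mul, map_pow, he0, he1, he2]
    ring
  have hqdeg : q.degree < (2 : ℕ) := lt_of_le_of_lt Polynomial.degree_linear_le (by exact_mod_cast Nat.one_lt_two)
  have hmonic : (e f).Monic := by rw [hef]; exact Polynomial.monic_X_pow_add hqdeg
  have hnat : (e f).natDegree = 2 := by
    rw [hef, Polynomial.natDegree_add_eq_left_of_degree_lt, Polynomial.natDegree_X_pow]
    rwa [Polynomial.degree_X_pow]
  have hc0 : (e f).coeff 0 = X 0 * X 1 ^ 2 := by
    rw [hef, hq, Polynomial.coeff_add, Polynomial.coeff_add, Polynomial.coeff_X_pow, Polynomial.coeff_C_mul_X,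
      Polynomial.coeff_C_zero]
    simp
  have hc1 : (e f).coeff 1 = X 0 ^ 2 * X 1 := by
    rw [hef, hq, Polynomial.coeff_add, Polynomial.coeff_add, Polynomial.coeff_X_pow, Polynomial.coeff_C_mul_X,
      Polynomial.coeff_C]
    simp
  -- Eisenstein at `𝓟 = (Y₀)`
  set 𝓟 : Ideal (MvPolynomial (Fin 2) k) := Ideal.span {X 0} with h𝓟
  have hP : 𝓟.IsPrime := (Ideal.span_singleton_prime (X_ne_zero (0 : Fin 2))).mpr X_prime
  have hE : (e f).IsEisensteinAt 𝓟 :=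
    { leading := by
        rw [hmonic.leadingCoeff]
        exact fun h1 => hP.ne_top ((Ideal.eq_top_iff_one _).mpr h1)
      mem := by
        intro i hi
        rw [hnat] at hi
        interval_cases i
        · rw [hc0]; exact Ideal.mem_span_singleton.mpr (dvd_mul_right _ _)
        · rw [hc1, pow_two, mul_assoc]; exact Ideal.mem_span_singleton.mpr (dvd_mul_right _ _)
      notMem := by
        rw [hc0, h𝓟, Ideal.span_singleton_pow, Ideal.mem_span_singleton, pow_two]
        intro h
        have h1 : (X 0 : MvPolynomial (Fin 2) k) ∣ X 1 ^ 2 := (mul_dvd_mul_iff_left (X_ne_zero (0 : Fin 2))).mp h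
        have h2 : (X 0 : MvPolynomial (Fin 2) k) ∣ X 1 := X_prime.dvd_of_dvd_pow h1
        exact absurd (X_dvd_X.mp h2) (by decide) }
  have hirr : Irreducible (e f) := hE.irreducible hP hmonic.isPrimitive (by rw [hnat]; exact Nat.two_pos)
  have hprime : Prime f := (MulEquiv.prime_iff e).mp hirr.prime
  have hdeg : ∀ j : Fin 3, (e (X j)).natDegree ≤ 1 := by
    intro j
    fin_cases j
    · simp [he0]
    · simp [he1]
    · simp [he2]
  refine ⟨hprime, fun j hdvd => ?_⟩
  have h1 : e f ∣ e (X j) := map_dvd e hdvd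
  have hne : e (X j) ≠ 0 := by rw [map_ne_zero_iff e e.injective]; exact X_ne_zero j
  have h2 := Polynomial.natDegree_le_of_dvd h1 hne
  rw [hnat] at h2
  have h3 := hdeg j
  omega

end Summit.ResolutionOfSingularities.ResolutionOfSingularities.Theorems.FInjectiveMacaulayfication.WildPinchClosedCentre
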